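import Mathlib
import HarnessLib
import Literature.MathematicalPhysics.QuantumLattice.HubbardFermiRadiusBandSmooth
import Summits.HubbardSuperconductivity.HubbardSuperconductivity.Theorems.KLProgrammeFreeBandJetExpr

/-!
# Route `KLProgramme` — ENGINE crux `KLRegimeEngineV17F2` (stmt-HubbardSuperconductivity-20437), row (C) `stub_twoLeg_curvature`,
# producer hypothesis `hcertA : KlwjCertA` — KLWJ-INKERNEL part 1b: THE CURVE DERIVATION IS SOUND; THE THREE JET TOWERS
# (cell gate-hubbard-kl, seat hubbard-kl-k3c5-p1 g21; docket «KLWJ-INKERNEL-ROUTE» (p1b g19 memo 5340b98f1348eb46); 0 kit)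

Sequel of `…FreeBandJetExpr` (jet expressions `JE`, semantics `JE.eval`, formal curve derivation `JE.Dc`).  Free band
`ε₀(k) = -2(cos k₁ + cos k₂)`, `F(θ, t) = ε₀(t·dir θ)` (`rayDispersion`), polar Fermi radius `u_μ = bandFermiRadius μ`
(`-4 < μ < 0`), radial slope `∂_tF` (`rayDispersionDt`), angular slope `u' = bandFermiRadiusDeriv μ` (`hasDerivAt_bandFermiRadius`).
* §3 the atom assignment `atomsAt θ t` and the closed forms `⟦E01⟧ = ∂_tF`, `⟦E10⟧ = ∂_θF`, `⟦V⟧ = -∂_θF/∂_tF`;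
* §4 **`hasDerivAt_eval_Dc`** — `HasDerivAt (θ ↦ ⟦e⟧(θ, u_μ θ)) (⟦Dc e⟧(θ, u_μ θ)) θ` for EVERY `e : JE` (structural induction: the
  seven atoms by the chain rule through `hasDerivAt_bandFermiRadius`, Leibniz, and the quotient rule on `divW` using `∂_tF > 0`
  along the curve), whence `iteratedDeriv_eval : iteratedDeriv k (θ ↦ ⟦e⟧) = ⟦Dc^[k] e⟧`;
* §5 the three towers of the polar-jet table: `iteratedDeriv k (bandFermiRadius μ) θ = ⟦Dc^[k] (atom 2)⟧`,
  `iteratedDeriv k (θ ↦ ∂_tF(θ, u_μ θ)) θ = ⟦Dc^[k] E01⟧`, `iteratedDeriv k (θ ↦ u_μ θ/∂_tF(θ, u_μ θ)) θ = ⟦Dc^[k] (divW (atom 2) 1)⟧`.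
Honest framing: elementary calculus of the FREE dispersion, generic in the level `μ ∈ (-4, 0)`; nothing here asserts any table entry,
row (C), any stub of 20437, K3, U₀, the window, a margin or superconductivity in the Hubbard model.
References: BGM 2006 §2.4 Lemma 2.1 (2.40) (polar description of the free Fermi curve) [cite: BenfattoGiulianiMastropietro2006];
forward-mode differentiation of straight-line programs (Griewank–Walther, *Evaluating Derivatives*, 2nd ed., SIAM 2008, §3.1) [folklore].
-/

noncomputable section

namespace Summit.HubbardSuperconductivity.HubbardSuperconductivity.Theorems.FreeBandJets

set_option linter.dupNamespace false -- summit = problem name (single-conjunct summit), D-0017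

open Real Set Literature.MathematicalPhysics.QuantumLattice

namespace JE

/-! ## §3 The atoms at a point `(θ, t)` and the three closed forms `W`, `∂_θF`, `u'` -/

/-- The atom assignment at `(θ, t)`. -/
def atomsAt (θ t : ℝ) : ℕ → ℝ
  | 0 => Real.cos θ
  | 1 => Real.sin θ
  | 2 => t
  | 3 => Real.sin (t * Real.cos θ)
  | 4 => Real.cos (t * Real.cos θ)
  | 5 => Real.sin (t * Real.sin θ)
  | 6 => Real.cos (t * Real.sin θ)
  | _ => 0

/-- Atom `0` is `cos θ`. -/
@[simp] theorem atomsAt_zero (θ t : ℝ) : atomsAt θ t 0 = Real.cos θ := rfl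
/-- Atom `1` is `sin θ`. -/
@[simp] theorem atomsAt_one (θ t : ℝ) : atomsAt θ t 1 = Real.sin θ := rfl
/-- Atom `2` is `t`. -/
@[simp] theorem atomsAt_two (θ t : ℝ) : atomsAt θ t 2 = t := rfl
/-- Atom `3` is `sin(t cos θ)`. -/
@[simp] theorem atomsAt_three (θ t : ℝ) : atomsAt θ t 3 = Real.sin (t * Real.cos θ) := rfl
/-- Atom `4` is `cos(t cos θ)`. -/
@[simp] theorem atomsAt_four (θ t : ℝ) : atomsAt θ t 4 = Real.cos (t * Real.cos θ) := rfl
/-- Atom `5` is `sin(t sin θ)`. -/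
@[simp] theorem atomsAt_five (θ t : ℝ) : atomsAt θ t 5 = Real.sin (t * Real.sin θ) := rfl
/-- Atom `6` is `cos(t sin θ)`. -/
@[simp] theorem atomsAt_six (θ t : ℝ) : atomsAt θ t 6 = Real.cos (t * Real.sin θ) := rfl
/-- Atoms `≥ 7` are `0`. -/
theorem atomsAt_of_ge {i : ℕ} (hi : 7 ≤ i) (θ t : ℝ) : atomsAt θ t i = 0 := by
  unfold atomsAt
  split <;> first | rfl | omega

/-- `W = ∂_tF(θ, t)`. -/
@[simp] theorem wval_atomsAt (θ t : ℝ) : wval (atomsAt θ t) = rayDispersionDt θ t := by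
  simp [wval, rayDispersionDt]

/-- `⟦F0⟧ = F(θ, t)`. -/
theorem eval_F0 (θ t : ℝ) : (F0).eval (atomsAt θ t) = rayDispersion (θ, t) := by
  rw [rayDispersion_eq]; simp [F0, eval]

/-- `⟦E01⟧ = ∂_tF(θ, t)`. -/
@[simp] theorem eval_E01 (θ t : ℝ) : E01.eval (atomsAt θ t) = rayDispersionDt θ t := by
  simp [E01, pd, F0, TT, rayDispersionDt]; ring

/-- `⟦E10⟧ = ∂_θF(θ, t)`. -/
@[simp] theorem eval_E10 (θ t : ℝ) : E10.eval (atomsAt θ t) = rayDispersionDθ θ t := by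
  simp [E10, pd, F0, TTH, rayDispersionDθ]; ring

/-- `⟦V⟧ = -∂_θF/∂_tF`. -/
@[simp] theorem eval_V (θ t : ℝ) : V.eval (atomsAt θ t) = -rayDispersionDθ θ t / rayDispersionDt θ t := by
  simp [V, neg_div]

/-! ## §4 The curve derivation is sound -/

section Curve

variable {μ : ℝ} (hμ₁ : -4 < μ) (hμ₂ : μ < 0)
include hμ₁ hμ₂

/-- The atoms along the curve `θ ↦ (θ, u_μ(θ))`. -/
def Bc (μ θ : ℝ) : ℕ → ℝ := atomsAt θ (bandFermiRadius μ θ)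

omit hμ₁ hμ₂ in
/-- Unfolding `Bc`. -/
theorem Bc_def (μ θ : ℝ) : Bc μ θ = atomsAt θ (bandFermiRadius μ θ) := rfl

omit hμ₁ hμ₂ in
/-- `⟦V⟧` along the curve is the closed-form slope `bandFermiRadiusDeriv`. -/
theorem eval_V_Bc (θ : ℝ) : V.eval (Bc μ θ) = bandFermiRadiusDeriv μ θ := by
  rw [Bc_def, eval_V, bandFermiRadiusDeriv, neg_div]

omit hμ₁ hμ₂ in
/-- `W` along the curve is the radial slope `∂_tF(θ, u_μ(θ))`. -/
theorem wval_Bc (θ : ℝ) : wval (Bc μ θ) = rayDispersionDt θ (bandFermiRadius μ θ) := by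
  rw [Bc_def, wval_atomsAt]

/-- `W > 0` along the curve. -/
theorem wval_Bc_pos (θ : ℝ) : 0 < wval (Bc μ θ) := by
  rw [wval_Bc]; exact rayDispersionDt_bandFermiRadius_pos hμ₁ hμ₂ θ

/-- **The atoms' curve derivatives**: `d/dθ aᵢ(θ, u_μ θ) = ⟦TTH i⟧ + ⟦TT i⟧·u'`. -/
theorem hasDerivAt_atom (i : ℕ) (θ : ℝ) :
    HasDerivAt (fun ϑ => Bc μ ϑ i) ((TTH i).eval (Bc μ θ) + (TT i).eval (Bc μ θ) * bandFermiRadiusDeriv μ θ) θ := by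
  have hu := hasDerivAt_bandFermiRadius hμ₁ hμ₂ θ
  have hc := Real.hasDerivAt_cos θ
  have hs := Real.hasDerivAt_sin θ
  match i with
  | 0 => simpa [TTH, TT, Bc_def] using hc
  | 1 => simpa [TTH, TT, Bc_def] using hs
  | 2 => simpa [TTH, TT, Bc_def] using hu
  | 3 =>
      have h : HasDerivAt (fun ϑ => Real.sin (bandFermiRadius μ ϑ * Real.cos ϑ))
          (Real.cos (bandFermiRadius μ θ * Real.cos θ) * (bandFermiRadiusDeriv μ θ * Real.cos θ + bandFermiRadius μ θ * -Real.sin θ)) θ := (hu.mul hc).sin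
      refine h.congr_deriv ?_
      simp [TTH, TT, Bc_def]; ring
  | 4 =>
      have h : HasDerivAt (fun ϑ => Real.cos (bandFermiRadius μ ϑ * Real.cos ϑ))
          (-Real.sin (bandFermiRadius μ θ * Real.cos θ) * (bandFermiRadiusDeriv μ θ * Real.cos θ + bandFermiRadius μ θ * -Real.sin θ)) θ := (hu.mul hc).cos
      refine h.congr_deriv ?_
      simp [TTH, TT, Bc_def]; ring
  | 5 =>
      have h : HasDerivAt (fun ϑ => Real.sin (bandFermiRadius μ ϑ * Real.sin ϑ))
          (Real.cos (bandFermiRadius μ θ * Real.sin θ) * (bandFermiRadiusDeriv μ θ * Real.sin θ + bandFermiRadius μ θ * Real.cos θ)) θ := (hu.mul hs).sin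
      refine h.congr_deriv ?_
      simp [TTH, TT, Bc_def]; ring
  | 6 =>
      have h : HasDerivAt (fun ϑ => Real.cos (bandFermiRadius μ ϑ * Real.sin ϑ))
          (-Real.sin (bandFermiRadius μ θ * Real.sin θ) * (bandFermiRadiusDeriv μ θ * Real.sin θ + bandFermiRadius μ θ * Real.cos θ)) θ := (hu.mul hs).cos
      refine h.congr_deriv ?_
      simp [TTH, TT, Bc_def]; ring
  | n + 7 =>
      have h0 : (fun ϑ => Bc μ ϑ (n + 7)) = fun _ => (0 : ℝ) := funext fun ϑ => atomsAt_of_ge (by omega) _ _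
      rw [h0]
      have h7 : TTH (n + 7) = const 0 := rfl
      have h7' : TT (n + 7) = const 0 := rfl
      simpa [h7, h7'] using hasDerivAt_const θ (0 : ℝ)

omit hμ₁ hμ₂ in
/-- `Dc` on an atom evaluates to the atom's curve derivative. -/
theorem eval_Dc_atom (i : ℕ) (θ : ℝ) :
    (Dc (atom i)).eval (Bc μ θ) = (TTH i).eval (Bc μ θ) + (TT i).eval (Bc μ θ) * bandFermiRadiusDeriv μ θ := by
  simp only [Dc]
  split
  · rename_i h; subst h
    have h2 : TTH 2 = const 0 := rfl
    have h2' : TT 2 = const 1 := rfl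
    simp [h2, h2', eval_V_Bc]
  · simp [eval_V_Bc]

/-- **Soundness of the curve derivation on `divW`-free expressions.** -/
theorem hasDerivAt_eval_DcDF : ∀ (e : JE), e.divFree = true → ∀ θ : ℝ,
    HasDerivAt (fun ϑ => e.eval (Bc μ ϑ)) ((DcDF e).eval (Bc μ θ)) θ
  | atom i, _, θ => by
      have h := hasDerivAt_atom hμ₁ hμ₂ i θ
      have he : (DcDF (atom i)).eval (Bc μ θ) = (Dc (atom i)).eval (Bc μ θ) := rfl
      rw [he, eval_Dc_atom]
      exact h
  | const z, _, θ => by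
      have h : (DcDF (const z)).eval (Bc μ θ) = 0 := by simp [DcDF]
      rw [h]; exact hasDerivAt_const θ (z : ℝ)
  | add a b, h, θ => by
      simp only [divFree, Bool.and_eq_true] at h
      have ha := hasDerivAt_eval_DcDF a h.1 θ
      have hb := hasDerivAt_eval_DcDF b h.2 θ
      exact (ha.add hb).congr_deriv (by simp [DcDF])
  | mul a b, h, θ => by
      simp only [divFree, Bool.and_eq_true] at h
      have ha := hasDerivAt_eval_DcDF a h.1 θ
      have hb := hasDerivAt_eval_DcDF b h.2 θ
      exact (ha.mul hb).congr_deriv (by simp [DcDF])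
  | neg a, h, θ => by
      simp only [divFree] at h
      have ha := hasDerivAt_eval_DcDF a h θ
      exact ha.neg.congr_deriv (by simp [DcDF])
  | divW _ _, h, _ => by simp [divFree] at h

/-- The curve derivative of the radial slope: `d/dθ W(θ, u_μ θ) = ⟦DW⟧`. -/
theorem hasDerivAt_wval (θ : ℝ) : HasDerivAt (fun ϑ => wval (Bc μ ϑ)) (DW.eval (Bc μ θ)) θ := by
  have h := hasDerivAt_eval_DcDF hμ₁ hμ₂ E01 divFree_E01 θ
  have hW : (fun ϑ => E01.eval (Bc μ ϑ)) = fun ϑ => wval (Bc μ ϑ) := by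
    funext ϑ; rw [Bc_def, eval_E01, wval_atomsAt]
  rw [hW] at h
  exact h

/-- **Soundness of the curve derivation.**  For every jet expression `e` and every angle `θ`:
`d/dθ ⟦e⟧(θ, u_μ(θ)) = ⟦Dc e⟧(θ, u_μ(θ))`. [cite: BenfattoGiulianiMastropietro2006, §2.4 Lemma 2.1 (2.40)] -/
theorem hasDerivAt_eval_Dc : ∀ (e : JE) (θ : ℝ),
    HasDerivAt (fun ϑ => e.eval (Bc μ ϑ)) ((Dc e).eval (Bc μ θ)) θ
  | atom i, θ => by
      have h := hasDerivAt_atom hμ₁ hμ₂ i θ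
      rw [eval_Dc_atom]
      exact h
  | const z, θ => by
      have h : (Dc (const z)).eval (Bc μ θ) = 0 := by simp [Dc]
      rw [h]; exact hasDerivAt_const θ (z : ℝ)
  | add a b, θ => by
      have ha := hasDerivAt_eval_Dc a θ
      have hb := hasDerivAt_eval_Dc b θ
      exact (ha.add hb).congr_deriv (by simp [Dc])
  | mul a b, θ => by
      have ha := hasDerivAt_eval_Dc a θ
      have hb := hasDerivAt_eval_Dc b θ
      exact (ha.mul hb).congr_deriv (by simp [Dc])
  | neg a, θ => by
      have ha := hasDerivAt_eval_Dc a θ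
      exact ha.neg.congr_deriv (by simp [Dc])
  | divW a n, θ => by
      have ha := hasDerivAt_eval_Dc a θ
      have hW := hasDerivAt_wval hμ₁ hμ₂ θ
      have hWn : HasDerivAt (fun ϑ => wval (Bc μ ϑ) ^ n)
          ((n : ℝ) * wval (Bc μ θ) ^ (n - 1) * DW.eval (Bc μ θ)) θ := hW.pow n
      have hW0 : wval (Bc μ θ) ≠ 0 := (wval_Bc_pos hμ₁ hμ₂ θ).ne'
      have hq : HasDerivAt (fun ϑ => a.eval (Bc μ ϑ) / wval (Bc μ ϑ) ^ n)
          (((Dc a).eval (Bc μ θ) * wval (Bc μ θ) ^ n -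
            a.eval (Bc μ θ) * ((n : ℝ) * wval (Bc μ θ) ^ (n - 1) * DW.eval (Bc μ θ))) / (wval (Bc μ θ) ^ n) ^ 2) θ :=
        ha.div hWn (pow_ne_zero n hW0)
      refine hq.congr_deriv ?_
      have hE : E01.eval (Bc μ θ) = wval (Bc μ θ) := by rw [Bc_def, eval_E01, wval_atomsAt]
      simp only [Dc, eval_divW', eval_sub', eval_mul', eval_smul', hE]
      push_cast
      rw [div_eq_div_iff (pow_ne_zero _ (pow_ne_zero n hW0)) (pow_ne_zero _ hW0)]
      cases n with
      | zero => simp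
      | succ m =>
          simp only [Nat.add_sub_cancel, Nat.cast_succ, pow_succ]
          ring

/-- **Iterated angular derivatives along the curve are computed by iterating `Dc`.** -/
theorem iteratedDeriv_eval (e : JE) : ∀ k : ℕ,
    iteratedDeriv k (fun θ => e.eval (Bc μ θ)) = fun θ => (Dc^[k] e).eval (Bc μ θ)
  | 0 => by simp
  | k + 1 => by
      rw [iteratedDeriv_succ, iteratedDeriv_eval e k, Function.iterate_succ_apply']
      funext θ
      exact (hasDerivAt_eval_Dc hμ₁ hμ₂ (Dc^[k] e) θ).deriv

/-! ## §5 The three towers of the polar-jet table -/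

/-- **Radius tower**: `u_μ^{(k)}(θ) = ⟦Dc^[k] (atom 2)⟧(θ, u_μ θ)`. -/
theorem iteratedDeriv_bandFermiRadius (k : ℕ) (θ : ℝ) :
    iteratedDeriv k (bandFermiRadius μ) θ = (Dc^[k] (atom 2)).eval (Bc μ θ) := by
  have h : bandFermiRadius μ = fun ϑ => (atom 2).eval (Bc μ ϑ) := by funext ϑ; simp [Bc_def]
  rw [h, iteratedDeriv_eval hμ₁ hμ₂ (atom 2) k]

/-- **Radial-slope tower**: `(d/dθ)^k ∂_tF(θ, u_μ θ) = ⟦Dc^[k] E01⟧(θ, u_μ θ)`. -/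
theorem iteratedDeriv_radialSlope (k : ℕ) (θ : ℝ) :
    iteratedDeriv k (fun ϑ => rayDispersionDt ϑ (bandFermiRadius μ ϑ)) θ = (Dc^[k] E01).eval (Bc μ θ) := by
  have h : (fun ϑ => rayDispersionDt ϑ (bandFermiRadius μ ϑ)) = fun ϑ => E01.eval (Bc μ ϑ) := by
    funext ϑ; simp [Bc_def]
  rw [h, iteratedDeriv_eval hμ₁ hμ₂ E01 k]

/-- **Polar-Jacobian tower**: `(d/dθ)^k (u_μ/∂_tF)(θ) = ⟦Dc^[k] (atom 2 / W)⟧(θ, u_μ θ)`. -/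
theorem iteratedDeriv_polarJac (k : ℕ) (θ : ℝ) :
    iteratedDeriv k (fun ϑ => bandFermiRadius μ ϑ / rayDispersionDt ϑ (bandFermiRadius μ ϑ)) θ =
      (Dc^[k] (divW (atom 2) 1)).eval (Bc μ θ) := by
  have h : (fun ϑ => bandFermiRadius μ ϑ / rayDispersionDt ϑ (bandFermiRadius μ ϑ)) =
      fun ϑ => (divW (atom 2) 1).eval (Bc μ ϑ) := by
    funext ϑ; simp [Bc_def]
  rw [h, iteratedDeriv_eval hμ₁ hμ₂ (divW (atom 2) 1) k]

end Curve

end JE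

end Summit.HubbardSuperconductivity.HubbardSuperconductivity.Theorems.FreeBandJets

end
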